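import Mathlib
import HarnessLib
import Summits.HubbardSuperconductivity.HubbardSuperconductivity.Theorems.KLProgrammeKLRegimeSplitSymInterpBounds

/-!
# Route `KLProgramme`, crux K3 — the `symInterp` TOOLKIT, part 5: ALIASING.  The interpolant of the lattice samples of a harmonic
# is the FOLDED harmonic; the interpolant of an absolutely summable cosine series is the folded series (part 5a; the derivative bound is part 5b)
# `‖D^j (evalM (symInterp L (H ∘ latticeMomentum L))) q - D^j H q‖ ≤ 2 Σ_{max(m,n) > L/2} |c(m,n)| (m+n)^j` at every order `j`

Cell gate-hubbard-kl, seat p2 (g6).  `--supports` the ENGINE child (stmt-HubbardSuperconductivity-19823 `KLRegimeEngineV11` and its gen-4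
twin): the registered stubs `stub_twoLeg_scale0` / `stub_twoLeg_step` owe SUP-FRÉCHET bounds `‖iteratedFDeriv ℝ j (evalM X) q‖` of objects
`X` that are `symInterp` outputs of SMOOTH SYMBOLS (`klTwoLegPolyG = klFrameExtG … = symInterp L (k ↦ m + χ_flat(k)(ν(angle k) − m))`,
BundleV6 §1–2).  Parts 1–4 (p2/p1b: `coeffNorm_symInterp_le`, decay from differences, `coeffNorm_one_symInterp_le_of_decay`) give the
WIENER route `‖D^j evalM (symInterp L f)‖ ≤ coeffNorm j ≤ Σ_x (1+|x̃|₁)^j |f_c(x)|`, which is the right tool when the data IS a lattice Fourier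
transform of a position-space kernel (the localised self-energy: the coefficients are the kernel, the weights are its moments), but which, for
the samples of a smooth symbol `H`, converges as `L → ∞` to the Wiener norm of `H` — larger than `sup ‖D^j H‖` by the inverse angular scale of
`H`.  This part gives the SUP route: the interpolant differs from the symbol only through the frequencies that the lattice FOLDS.

* §1 `foldFreq L m = |valMinAbs (m : ZMod L)|` — the folded frequency: `≤ m`, `≤ L/2`, `= m` for `m ≤ L/2`.
* §2 **`eval_symInterp_harmonic_comp_latticeMomentum`**: `(symInterp L (h_{m,n} ∘ latticeMomentum L)).eval p = h_{foldFreq L m, foldFreq L n}(p)`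
  at EVERY continuum momentum `p` (the cosine coefficients of the samples of `h_{m,n}` are `⅛ Σ_{v ∈ D₄·(m,n)} [x = v]`, by character
  orthogonality `sum_torusChar_left`; each of the eight sites carries the harmonic `h_{fold m, fold n}`).  In particular harmonics of the
  interpolation band (`m, n ≤ L/2`) are reproduced exactly (`eval_symInterp_harmonic_comp_latticeMomentum_of_le`).
* §3 `cosSeries c p = Σ' c(m,n) h_{m,n}(p)` (absolutely summable coefficient families on `ℕ × ℕ`) and **`eval_symInterp_cosSeries`**: the
  interpolant of its samples is the folded series `Σ' c(m,n) h_{fold m, fold n}` (finite sums commute with `tsum`).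
* the aliasing tail `aliasTail L c j = Σ' [L/2 < m ∨ L/2 < n] |c(m,n)|(m+n)^j` and the VALUE-level bound
  **`abs_eval_symInterp_sub_cosSeries_le`**: `|I_L[H](p) − H(p)| ≤ 2·aliasTail L c 0`.  Part 5b (`…SymInterpAliasingDeriv`) differentiates
  both series termwise and proves `‖D^j I_L[H](q) − D^j H(q)‖ ≤ 2·aliasTail L c j` at every order — the in-band terms cancel exactly.

Nothing is asserted about the model; everything is proved.  References: A. Zygmund, *Trigonometric Series*, Ch. X §2 (interpolation =
partial sums + aliasing); HOME/p2-g6/DELTA-INTERP.md (why the engine needs the sup route).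
-/

noncomputable section

namespace Summit.HubbardSuperconductivity.HubbardSuperconductivity.Theorems.KLRegimeSplit

set_option linter.dupNamespace false -- summit = problem name (single-conjunct summit), D-0017

open Real Finset Literature.MathematicalPhysics.QuantumLattice Literature.Probability.LatticeModels
open scoped ComplexConjugate

/-! ## §1 The folded frequency -/

/-- **The folded frequency** of `m` on the `L`-lattice: `|valMinAbs (m : ZMod L)|` — the frequency that the samples of `cos(m·)` on the
grid `2πℤ/L` actually show (`m ↦ m` for `m ≤ L/2`, `m ↦ L − m` for `L/2 < m < L`, periodically). -/
def foldFreq (L : ℕ) (m : ℕ) : ℕ := ((m : ZMod L)).valMinAbs.natAbs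

variable {L : ℕ} [NeZero L]

/-- The folded frequency lies in the interpolation band: `foldFreq L m ≤ L/2`. -/
theorem foldFreq_le_half (m : ℕ) : foldFreq L m ≤ L / 2 := ZMod.natAbs_valMinAbs_le _

omit [NeZero L] in
/-- Frequencies in the band are not folded: `foldFreq L m = m` for `m ≤ L/2`. -/
theorem foldFreq_of_le_half {m : ℕ} (h : m ≤ L / 2) : foldFreq L m = m := by
  unfold foldFreq
  rw [ZMod.valMinAbs_natCast_of_le_half h, Int.natAbs_natCast]

/-- Folding never raises a frequency: `foldFreq L m ≤ m`. -/
theorem foldFreq_le (m : ℕ) : foldFreq L m ≤ m := by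
  by_cases h : m ≤ L / 2
  · exact (foldFreq_of_le_half h).le
  · exact (foldFreq_le_half m).trans (le_of_lt (not_le.mp h))

omit [NeZero L] in
/-- The folded frequency of `-m` (as a residue) is that of `m`. -/
theorem natAbs_valMinAbs_neg_natCast (m : ℕ) : (-(m : ZMod L)).valMinAbs.natAbs = foldFreq L m :=
  ZMod.natAbs_valMinAbs_neg _

omit [NeZero L] in
/-- The folded frequency read off the residue itself. -/
theorem natAbs_valMinAbs_natCast (m : ℕ) : ((m : ZMod L)).valMinAbs.natAbs = foldFreq L m := rfl

/-! ## §2 The interpolant of the samples of ONE harmonic is the folded harmonic -/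

/-- A lattice phase `cos(m·p_{k,0} + s·n·p_{k,1})` (`s = ±1` encoded by the residue `±n`) as the real part of a character value:
`cos (m p_{k,0} + n p_{k,1}) = Re χ_k(![m, n])` and `cos (m p_{k,0} - n p_{k,1}) = Re χ_k(![m, -n])`. -/
theorem cos_natMul_latticeMomentum_add (m n : ℕ) (k : TorusSite 2 L) :
    Real.cos (m * latticeMomentum L k 0 + n * latticeMomentum L k 1) =
      (torusChar k (![(m : ZMod L), (n : ZMod L)] : TorusSite 2 L)).re := by
  have h := cos_latticeMomentum_phase_two k (![(m : ZMod L), (n : ZMod L)] : TorusSite 2 L) (m : ℤ) (n : ℤ)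
    (by simp) (by simp)
  rw [← h]
  congr 1
  push_cast
  ring

/-- The companion with a minus sign: `cos (m p_{k,0} - n p_{k,1}) = Re χ_k(![m, -n])`. -/
theorem cos_natMul_latticeMomentum_sub (m n : ℕ) (k : TorusSite 2 L) :
    Real.cos (m * latticeMomentum L k 0 - n * latticeMomentum L k 1) =
      (torusChar k (![(m : ZMod L), -(n : ZMod L)] : TorusSite 2 L)).re := by
  have h := cos_latticeMomentum_phase_two k (![(m : ZMod L), -(n : ZMod L)] : TorusSite 2 L) (m : ℤ) (-(n : ℤ))
    (by simp) (by simp)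
  rw [← h]
  congr 1
  push_cast
  ring

/-- The real part of a character value as a complex number: `(Re χ_k(v) : ℂ) = (χ_k(v) + χ_k(-v)) / 2`. -/
theorem ofReal_re_torusChar (k v : TorusSite 2 L) :
    (((torusChar k v).re : ℝ) : ℂ) = (torusChar k v + torusChar k (-v)) / 2 := by
  rw [torusChar_neg_right, Complex.add_conj, Complex.ofReal_mul, Complex.ofReal_ofNat]
  ring

/-- The four frequency vectors of the harmonic `h_{m,n}`: `(m,n), (m,-n), (n,m), (n,-m)` as torus sites. -/
def harmonicVecs (L : ℕ) (m n : ℕ) : Fin 4 → TorusSite 2 L :=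
  ![![(m : ZMod L), (n : ZMod L)], ![(m : ZMod L), -(n : ZMod L)], ![(n : ZMod L), (m : ZMod L)], ![(n : ZMod L), -(m : ZMod L)]]

/-- **The samples of a harmonic are an eighth of a sum of eight characters**:
`(h_{m,n}(p_k) : ℂ) = ⅛ Σ_{i<4} (χ_k(v_i) + χ_k(-v_i))`, `v = harmonicVecs L m n`. -/
theorem ofReal_harmonic_latticeMomentum (m n : ℕ) (k : TorusSite 2 L) :
    ((TrigPolyC4v.harmonic m n (latticeMomentum L k) : ℝ) : ℂ) =
      (1 / 8 : ℂ) * ∑ i : Fin 4, (torusChar k (harmonicVecs L m n i) + torusChar k (-(harmonicVecs L m n i))) := by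
  have hre : TrigPolyC4v.harmonic m n (latticeMomentum L k) =
      ((torusChar k (harmonicVecs L m n 0)).re + (torusChar k (harmonicVecs L m n 1)).re +
        (torusChar k (harmonicVecs L m n 2)).re + (torusChar k (harmonicVecs L m n 3)).re) / 4 := by
    have hcc : ∀ a b : ℝ, Real.cos a * Real.cos b = (Real.cos (a + b) + Real.cos (a - b)) / 2 := fun a b => by
      rw [Real.cos_add, Real.cos_sub]; ring
    unfold TrigPolyC4v.harmonic
    rw [hcc, hcc, cos_natMul_latticeMomentum_add, cos_natMul_latticeMomentum_sub,
      cos_natMul_latticeMomentum_add, cos_natMul_latticeMomentum_sub]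
    simp only [harmonicVecs, Matrix.cons_val_zero, Matrix.cons_val_one, Matrix.cons_val]
    ring
  rw [hre]
  push_cast
  rw [ofReal_re_torusChar, ofReal_re_torusChar, ofReal_re_torusChar, ofReal_re_torusChar, Fin.sum_univ_four]
  simp only [harmonicVecs, Matrix.cons_val_zero, Matrix.cons_val_one, Matrix.cons_val]
  ring

/-- Character orthogonality read for a product: `Σ_k χ_k(v) χ_k(x) = L²·[x = -v]`. -/
theorem sum_torusChar_mul_torusChar (v x : TorusSite 2 L) :
    ∑ k : TorusSite 2 L, torusChar k v * torusChar k x = if x = -v then ((L : ℂ) ^ 2) else 0 := by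
  simp_rw [← torusChar_add_right]
  rw [sum_torusChar_left]
  have h : (v + x = 0) ↔ (x = -v) := by
    constructor
    · intro h; exact eq_neg_of_add_eq_zero_right h
    · intro h; rw [h, add_neg_cancel]
  simp only [h]

/-- **The cosine coefficients of the samples of a harmonic**: `(h_{m,n} ∘ p)_c(x) = ⅛ Σ_{i<4} ([x = -v_i] + [x = v_i])` — an eighth of
the number of elements of the `D₄`-orbit of `(m,n)` (with multiplicity) congruent to `x`. -/
theorem torusCosCoeff_harmonic_comp_latticeMomentum (m n : ℕ) (x : TorusSite 2 L) :
    torusCosCoeff L (fun k => TrigPolyC4v.harmonic m n (latticeMomentum L k)) x =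
      (1 / 8 : ℝ) * ∑ i : Fin 4, ((if x = -(harmonicVecs L m n i) then (1 : ℝ) else 0) +
        (if x = harmonicVecs L m n i then (1 : ℝ) else 0)) := by
  classical
  rw [torusCosCoeff_eq_re]
  have hsum : ∑ k : TorusSite 2 L, ((TrigPolyC4v.harmonic m n (latticeMomentum L k) : ℝ) : ℂ) * torusChar k x =
      (((1 / 8 : ℝ) * ∑ i : Fin 4, ((if x = -(harmonicVecs L m n i) then ((L : ℝ) ^ 2) else 0) +
        (if x = harmonicVecs L m n i then ((L : ℝ) ^ 2) else 0)) : ℝ) : ℂ) := by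
    calc ∑ k : TorusSite 2 L, ((TrigPolyC4v.harmonic m n (latticeMomentum L k) : ℝ) : ℂ) * torusChar k x
        = ∑ k : TorusSite 2 L, (1 / 8 : ℂ) * ∑ i : Fin 4,
            (torusChar k (harmonicVecs L m n i) * torusChar k x + torusChar k (-(harmonicVecs L m n i)) * torusChar k x) := by
          refine Finset.sum_congr rfl fun k _ => ?_
          rw [ofReal_harmonic_latticeMomentum, mul_assoc, Finset.sum_mul]
          congr 1
          exact Finset.sum_congr rfl fun i _ => add_mul _ _ _
      _ = (1 / 8 : ℂ) * ∑ i : Fin 4, ((∑ k : TorusSite 2 L, torusChar k (harmonicVecs L m n i) * torusChar k x) +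
            ∑ k : TorusSite 2 L, torusChar k (-(harmonicVecs L m n i)) * torusChar k x) := by
          rw [← Finset.mul_sum, Finset.sum_comm]
          simp_rw [Finset.sum_add_distrib]
      _ = (1 / 8 : ℂ) * ∑ i : Fin 4, ((if x = -(harmonicVecs L m n i) then ((L : ℂ) ^ 2) else 0) +
            (if x = harmonicVecs L m n i then ((L : ℂ) ^ 2) else 0)) := by
          congr 1
          refine Finset.sum_congr rfl fun i _ => ?_
          rw [sum_torusChar_mul_torusChar, sum_torusChar_mul_torusChar, neg_neg]
      _ = (((1 / 8 : ℝ) * ∑ i : Fin 4, ((if x = -(harmonicVecs L m n i) then ((L : ℝ) ^ 2) else 0) +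
            (if x = harmonicVecs L m n i then ((L : ℝ) ^ 2) else 0)) : ℝ) : ℂ) := by
          push_cast
          congr 1
          refine Finset.sum_congr rfl fun i _ => ?_
          split_ifs <;> simp
  rw [hsum, Complex.ofReal_re]
  have hL : ((L : ℝ) ^ 2) ≠ 0 := pow_ne_zero _ (Nat.cast_ne_zero.2 (NeZero.ne L))
  have hfac : (∑ i : Fin 4, ((if x = -(harmonicVecs L m n i) then ((L : ℝ) ^ 2) else 0) +
      (if x = harmonicVecs L m n i then ((L : ℝ) ^ 2) else 0))) =
      (L : ℝ) ^ 2 * ∑ i : Fin 4, ((if x = -(harmonicVecs L m n i) then (1 : ℝ) else 0) +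
        (if x = harmonicVecs L m n i then (1 : ℝ) else 0)) := by
    rw [Finset.mul_sum]
    refine Finset.sum_congr rfl fun i _ => ?_
    split_ifs <;> ring
  rw [hfac, mul_left_comm, inv_mul_cancel_left₀ hL]

omit [NeZero L] in
/-- Each vector of the `D₄`-orbit of `(m, n)`, and its negative, indexes the harmonic `h_{fold m, fold n}`. -/
theorem harmonic_natAbs_harmonicVecs (m n : ℕ) (i : Fin 4) (p : Fin 2 → ℝ) :
    TrigPolyC4v.harmonic ((harmonicVecs L m n i) 0).valMinAbs.natAbs ((harmonicVecs L m n i) 1).valMinAbs.natAbs p =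
        TrigPolyC4v.harmonic (foldFreq L m) (foldFreq L n) p ∧
      TrigPolyC4v.harmonic ((-(harmonicVecs L m n i)) 0).valMinAbs.natAbs ((-(harmonicVecs L m n i)) 1).valMinAbs.natAbs p =
        TrigPolyC4v.harmonic (foldFreq L m) (foldFreq L n) p := by
  fin_cases i <;>
    simp [harmonicVecs, foldFreq, ZMod.natAbs_valMinAbs_neg, TrigPolyC4v.harmonic_symm]

/-- **THE FOLDING IDENTITY.**  The symmetrised interpolant of the lattice samples of the harmonic `h_{m,n}` IS the folded harmonic,
at EVERY continuum momentum: `(symInterp L (h_{m,n} ∘ latticeMomentum L)).eval p = h_{foldFreq L m, foldFreq L n}(p)`. -/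
theorem eval_symInterp_harmonic_comp_latticeMomentum (m n : ℕ) (p : Fin 2 → ℝ) :
    (symInterp L (fun k => TrigPolyC4v.harmonic m n (latticeMomentum L k))).eval p =
      TrigPolyC4v.harmonic (foldFreq L m) (foldFreq L n) p := by
  classical
  rw [eval_symInterp]
  set H : TorusSite 2 L → ℝ := fun x => TrigPolyC4v.harmonic (x 0).valMinAbs.natAbs (x 1).valMinAbs.natAbs p with hH
  set v := harmonicVecs L m n with hv
  have hstep : ∀ x : TorusSite 2 L,
      torusCosCoeff L (fun k => TrigPolyC4v.harmonic m n (latticeMomentum L k)) x * H x =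
        (1 / 8 : ℝ) * ∑ i : Fin 4, ((if x = -(v i) then H x else 0) + (if x = v i then H x else 0)) := by
    intro x
    rw [torusCosCoeff_harmonic_comp_latticeMomentum, mul_assoc, mul_comm (∑ i : Fin 4, _) (H x), Finset.mul_sum]
    congr 1
    refine Finset.sum_congr rfl fun i _ => ?_
    split_ifs <;> ring
  calc ∑ x : TorusSite 2 L, torusCosCoeff L (fun k => TrigPolyC4v.harmonic m n (latticeMomentum L k)) x * H x
      = ∑ x : TorusSite 2 L, (1 / 8 : ℝ) * ∑ i : Fin 4, ((if x = -(v i) then H x else 0) + (if x = v i then H x else 0)) :=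
        Finset.sum_congr rfl fun x _ => hstep x
    _ = (1 / 8 : ℝ) * ∑ i : Fin 4, ((∑ x : TorusSite 2 L, if x = -(v i) then H x else 0) +
          ∑ x : TorusSite 2 L, if x = v i then H x else 0) := by
        rw [← Finset.mul_sum, Finset.sum_comm]
        simp_rw [Finset.sum_add_distrib]
    _ = (1 / 8 : ℝ) * ∑ i : Fin 4, (H (-(v i)) + H (v i)) := by
        congr 1
        refine Finset.sum_congr rfl fun i _ => ?_
        rw [Finset.sum_ite_eq' Finset.univ (-(v i)) H, Finset.sum_ite_eq' Finset.univ (v i) H]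
        simp
    _ = (1 / 8 : ℝ) * ∑ _i : Fin 4, 2 * TrigPolyC4v.harmonic (foldFreq L m) (foldFreq L n) p := by
        congr 1
        refine Finset.sum_congr rfl fun i _ => ?_
        rw [hH]
        dsimp only
        rw [(harmonic_natAbs_harmonicVecs m n i p).2, (harmonic_natAbs_harmonicVecs m n i p).1]
        ring
    _ = TrigPolyC4v.harmonic (foldFreq L m) (foldFreq L n) p := by
        rw [Finset.sum_const, Finset.card_univ, Fintype.card_fin]
        simp only [nsmul_eq_mul, Nat.cast_ofNat]
        ring

/-- Harmonics of the interpolation band are reproduced exactly. -/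
theorem eval_symInterp_harmonic_comp_latticeMomentum_of_le {m n : ℕ} (hm : m ≤ L / 2) (hn : n ≤ L / 2) (p : Fin 2 → ℝ) :
    (symInterp L (fun k => TrigPolyC4v.harmonic m n (latticeMomentum L k))).eval p = TrigPolyC4v.harmonic m n p := by
  rw [eval_symInterp_harmonic_comp_latticeMomentum, foldFreq_of_le_half hm, foldFreq_of_le_half hn]

/-! ## §3 Absolutely summable cosine series («infinite frames») and their interpolants -/

/-- **An absolutely summable symmetrised cosine series** `H(p) = Σ'_{(m,n)} c(m,n)·h_{m,n}(p)` — the shape of a smooth `D₄`-symmetric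
`2π`-periodic symbol expanded in the harmonics `h_{m,n}`. -/
def cosSeries (c : ℕ × ℕ → ℝ) (p : Fin 2 → ℝ) : ℝ := ∑' mn : ℕ × ℕ, c mn * TrigPolyC4v.harmonic mn.1 mn.2 p

/-- The terms of a cosine series with absolutely summable coefficients are summable at every point (`|h_{m,n}| ≤ 1`). -/
theorem summable_mul_harmonic {c : ℕ × ℕ → ℝ} (hc : Summable fun mn => |c mn|) (a b : ℕ × ℕ → ℕ) (p : Fin 2 → ℝ) :
    Summable fun mn : ℕ × ℕ => c mn * TrigPolyC4v.harmonic (a mn) (b mn) p := by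
  refine Summable.of_norm_bounded hc fun mn => ?_
  rw [Real.norm_eq_abs, abs_mul]
  exact mul_le_of_le_one_right (abs_nonneg _) (TrigPolyC4v.abs_harmonic_le_one _ _ _)

/-- The cosine coefficients of pointwise-summable data are the sums of the cosine coefficients (a finite sum commutes with `tsum`). -/
theorem torusCosCoeff_tsum {ι : Type*} (g : ι → TorusSite 2 L → ℝ) (hg : ∀ k, Summable fun i => g i k) (x : TorusSite 2 L) :
    torusCosCoeff L (fun k => ∑' i, g i k) x = ∑' i, torusCosCoeff L (g i) x := by
  unfold torusCosCoeff
  have h1 : ∀ k : TorusSite 2 L, (∑' i, g i k) * Real.cos (∑ j : Fin 2, latticeMomentum L k j * ((x j).valMinAbs : ℝ)) =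
      ∑' i, g i k * Real.cos (∑ j : Fin 2, latticeMomentum L k j * ((x j).valMinAbs : ℝ)) := fun k => by
    rw [tsum_mul_right]
  simp_rw [h1]
  rw [← Summable.tsum_finsetSum (fun k _ => (hg k).mul_right _), tsum_mul_left]

/-- The cosine coefficients of pointwise-summable data are summable in the summation index. -/
theorem summable_torusCosCoeff {ι : Type*} (g : ι → TorusSite 2 L → ℝ) (hg : ∀ k, Summable fun i => g i k) (x : TorusSite 2 L) :
    Summable fun i => torusCosCoeff L (g i) x := by
  unfold torusCosCoeff
  exact (summable_sum fun k _ => (hg k).mul_right _).mul_left _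

/-- **The interpolant of pointwise-summable data is the sum of the interpolants**, at the level of values. -/
theorem eval_symInterp_tsum {ι : Type*} (g : ι → TorusSite 2 L → ℝ) (hg : ∀ k, Summable fun i => g i k) (p : Fin 2 → ℝ) :
    (symInterp L (fun k => ∑' i, g i k)).eval p = ∑' i, (symInterp L (g i)).eval p := by
  rw [eval_symInterp]
  simp_rw [torusCosCoeff_tsum g hg, eval_symInterp]
  have h1 : ∀ x : TorusSite 2 L, (∑' i, torusCosCoeff L (g i) x) *
      TrigPolyC4v.harmonic (x 0).valMinAbs.natAbs (x 1).valMinAbs.natAbs p =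
      ∑' i, torusCosCoeff L (g i) x * TrigPolyC4v.harmonic (x 0).valMinAbs.natAbs (x 1).valMinAbs.natAbs p := fun x => by
    rw [tsum_mul_right]
  simp_rw [h1]
  rw [← Summable.tsum_finsetSum (fun x _ => (summable_torusCosCoeff g hg x).mul_right _)]

/-- **THE INTERPOLANT OF A COSINE SERIES IS THE FOLDED SERIES**: for absolutely summable `c`,
`(symInterp L (cosSeries c ∘ latticeMomentum L)).eval p = Σ' c(m,n)·h_{foldFreq L m, foldFreq L n}(p)` at every continuum momentum `p`. -/
theorem eval_symInterp_cosSeries {c : ℕ × ℕ → ℝ} (hc : Summable fun mn => |c mn|) (p : Fin 2 → ℝ) :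
    (symInterp L (fun k => cosSeries c (latticeMomentum L k))).eval p =
      ∑' mn : ℕ × ℕ, c mn * TrigPolyC4v.harmonic (foldFreq L mn.1) (foldFreq L mn.2) p := by
  unfold cosSeries
  rw [eval_symInterp_tsum (fun mn k => c mn * TrigPolyC4v.harmonic mn.1 mn.2 (latticeMomentum L k))
    (fun k => summable_mul_harmonic hc _ _ _)]
  refine tsum_congr fun mn => ?_
  rw [eval_symInterp_const_mul, eval_symInterp_harmonic_comp_latticeMomentum]

/-- **The aliasing tail of order `j`** of the coefficient family `c` on the `L`-lattice: `Σ' [L/2 < m ∨ L/2 < n] |c(m,n)|·(m+n)^j` — the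
weight-`j` mass of the coefficients OUTSIDE the interpolation band.  It is the tail of a convergent series whenever `Σ |c|(1+m+n)^j < ∞`,
hence `→ 0` as `L → ∞`, at a rate set by any spare decay of `c`. -/
def aliasTail (L : ℕ) (c : ℕ × ℕ → ℝ) (j : ℕ) : ℝ :=
  ∑' mn : ℕ × ℕ, if (L / 2 < mn.1 ∨ L / 2 < mn.2) then |c mn| * ((mn.1 : ℝ) + mn.2) ^ j else 0

/-- **Aliasing bound for VALUES** (`j = 0`, any continuum momentum): `|I_L[H](p) − H(p)| ≤ 2·Σ' [tail] |c(m,n)|`. -/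
theorem abs_eval_symInterp_sub_cosSeries_le {c : ℕ × ℕ → ℝ} (hc : Summable fun mn => |c mn|) (p : Fin 2 → ℝ) :
    |(symInterp L (fun k => cosSeries c (latticeMomentum L k))).eval p - cosSeries c p| ≤ 2 * aliasTail L c 0 := by
  rw [eval_symInterp_cosSeries hc, cosSeries, aliasTail]
  have hs1 := summable_mul_harmonic hc (fun mn => foldFreq L mn.1) (fun mn => foldFreq L mn.2) p
  have hs2 := summable_mul_harmonic hc (fun mn => mn.1) (fun mn => mn.2) p
  rw [← hs1.tsum_sub hs2]
  have hterm : ∀ mn : ℕ × ℕ, |c mn * TrigPolyC4v.harmonic (foldFreq L mn.1) (foldFreq L mn.2) p -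
      c mn * TrigPolyC4v.harmonic mn.1 mn.2 p| ≤
      2 * (if (L / 2 < mn.1 ∨ L / 2 < mn.2) then |c mn| * ((mn.1 : ℝ) + mn.2) ^ 0 else 0) := by
    intro mn
    split_ifs with h
    · rw [pow_zero, mul_one, ← mul_sub, abs_mul]
      have h2 : |TrigPolyC4v.harmonic (foldFreq L mn.1) (foldFreq L mn.2) p - TrigPolyC4v.harmonic mn.1 mn.2 p| ≤ 2 := by
        have := TrigPolyC4v.abs_harmonic_le_one (foldFreq L mn.1) (foldFreq L mn.2) p
        have := TrigPolyC4v.abs_harmonic_le_one mn.1 mn.2 p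
        calc |TrigPolyC4v.harmonic (foldFreq L mn.1) (foldFreq L mn.2) p - TrigPolyC4v.harmonic mn.1 mn.2 p|
            ≤ |TrigPolyC4v.harmonic (foldFreq L mn.1) (foldFreq L mn.2) p| + |TrigPolyC4v.harmonic mn.1 mn.2 p| := abs_sub _ _
          _ ≤ 2 := by linarith
      nlinarith [abs_nonneg (c mn)]
    · push Not at h
      rw [foldFreq_of_le_half h.1, foldFreq_of_le_half h.2, sub_self, abs_zero, mul_zero]
  have hsum : Summable fun mn : ℕ × ℕ => 2 * (if (L / 2 < mn.1 ∨ L / 2 < mn.2) then |c mn| * ((mn.1 : ℝ) + mn.2) ^ 0 else 0) := by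
    refine (Summable.of_nonneg_of_le (fun mn => ?_) (fun mn => ?_) hc).mul_left 2
    · split_ifs <;> simp [abs_nonneg]
    · split_ifs <;> simp [abs_nonneg]
  calc |∑' mn : ℕ × ℕ, (c mn * TrigPolyC4v.harmonic (foldFreq L mn.1) (foldFreq L mn.2) p - c mn * TrigPolyC4v.harmonic mn.1 mn.2 p)|
      ≤ ∑' mn : ℕ × ℕ, |c mn * TrigPolyC4v.harmonic (foldFreq L mn.1) (foldFreq L mn.2) p - c mn * TrigPolyC4v.harmonic mn.1 mn.2 p| := by
        have h := norm_tsum_le_tsum_norm ((hs1.sub hs2).norm)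
        simpa only [Real.norm_eq_abs] using h
    _ ≤ ∑' mn : ℕ × ℕ, 2 * (if (L / 2 < mn.1 ∨ L / 2 < mn.2) then |c mn| * ((mn.1 : ℝ) + mn.2) ^ 0 else 0) :=
        Summable.tsum_le_tsum hterm ((hs1.sub hs2).abs) hsum
    _ = 2 * ∑' mn : ℕ × ℕ, (if (L / 2 < mn.1 ∨ L / 2 < mn.2) then |c mn| * ((mn.1 : ℝ) + mn.2) ^ 0 else 0) := tsum_mul_left

end Summit.HubbardSuperconductivity.HubbardSuperconductivity.Theorems.KLRegimeSplit

end
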